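import Summits.Parity.BatemanHorn.Theorems.AlmostPrimeZerosSystemZeroRepulsionApTiltedReindex
import Summits.Parity.BatemanHorn.Theorems.AlmostPrimeZerosDiscMajorantLogGrowingDiscXOfParts
import HarnessLib

/-!
# Crux `DiscMajorantLog` (stmt-Parity-17114), line `Sketch`, stub `stub_growingDiscLinearOfCharBound`

Support lemma for the crux `Summit.Parity.BatemanHorn.Theses.AlmostPrimeZeros.DiscMajorantLog`
(line `Sketch`): the cell `k = 1`, `f = aX + b` with `a ≥ 2`, `gcd(a, b) = 1` (class `linₐ`) of the
crux on the GROWING disc `‖z − 1‖ ≤ 3 log log x` with the Γ-budget `e^{C‖z−1‖ log(‖z−1‖+2)}`,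
DERIVED from the per-character bound (CHAR, the conclusion of the neighbouring stub
`stub_apCharBoundSharpOfParts`, taken here as the hypothesis)

  `‖Σ_{0<n≤y} χ(n) z^{s(n)}‖ ≤ A_χ · y · (log y)^{Re z − 1} · e^{C_χ ‖z−1‖ log(‖z−1‖+2)}`
  (`y ≥ y₀(χ)`, `‖z − 1‖ ≤ 3 log log y`), `s(m) = Σ_{p^v ∥ m} min(v, 2)`.

Pure bookkeeping, all arithmetic pieces being the landed lemmas of
`…SystemZeroRepulsionApTiltedReindex` (namespace `…SystemZeroRepulsion.NearFar`):
* the crux exponent of `f = (C a * X + C b)` at `n` is `s((an + b)⁺)` (`exponent_linear`);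
* `stub_apTiltedReindex`: `Σ_{n≤x} z^{s((an+b)⁺)} = N₀ + U − B₁` with `N₀ = #{n ≤ x : an+b ≤ 0} ≤ |b|+1`,
  `U = Σ_{0<m≤y, m≡b (a)} z^{s(m)}` (`y = ax + b`), `‖B₁‖ ≤ |b| (1+r)^{2|b|+2}` (`r = ‖z − 1‖`);
* uniform constants over the finitely many characters mod `q = a` (`A* = Σ_χ |A_χ|`,
  `C* = Σ_χ |C_χ|`, `y₀* = Σ_χ y₀(χ)`), then orthogonality (`norm_progression_sum_le`, `b` a unit
  mod `a`): `‖U‖ ≤ #{χ} · A* · y (log y)^{Re z−1} e^{C* r log(r+2)}`, legitimately since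
  `x ≤ y` gives `3 log log x ≤ 3 log log y`;
* size conversion `y ≤ κ x`, `κ = a + |b|`: `(log y)^{Re z−1} ≤ (log x)^{Re z−1} e^{r log κ}`
  (`log_rpow_le_of_le_mul`) and `r log κ ≤ 2 log κ · r log(r+2)` (`log 2 > 1/2`);
* boundary terms: `(1+r)^N ≤ e^{N r} ≤ e^{2N r log(r+2)}` and `x (log x)^{Re z−1} ≥ 1` on the growing
  disc once `log log x ≥ 9` (`3ℓ² ≤ e^ℓ`, `GrowingDiscX.three_sq_le_exp`).
Constants: `A = 2|b| + 1 + #{χ}·A*·κ`, `C = C* + 2 log κ + 2(2|b|+2)`,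
`x₀ = max (max y₀* |b|) ⌈exp(exp 9)⌉₊`.  Reference for the cell: H. L. Montgomery, R. C. Vaughan,
*Multiplicative Number Theory I*, CUP 2007, §7.4 and §11.3.
-/

noncomputable section

namespace Summit.Parity.BatemanHorn.Cruxes.DiscMajorantLog.Sketch

open Polynomial
open scoped BigOperators
open Summit.Parity.BatemanHorn.Cruxes.SystemZeroRepulsion.NearFar

namespace GrowingDiscLinearAP

/-- For the system `f = (C a * X + C b)` the crux's exponent `Σ_i Σ_{p^v ∥ f_i(n)} min(v,2)` at `n`
is the capped statistic `s` of the natural number `(a n + b)⁺ = (a * n + b).toNat`. [folklore] -/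
theorem exponent_linear (a b : ℤ) (n : ℕ) :
    (∑ i, ((((![Polynomial.C a * Polynomial.X + Polynomial.C b] : Fin 1 → Polynomial ℤ) i).eval
      (n : ℤ)).toNat.factorization.sum fun _ v => min v 2)) =
      ((a * (n : ℤ) + b).toNat).factorization.sum fun _ v => min v 2 := by
  simp [Matrix.cons_val_fin_one, eval_add, eval_mul, eval_X]

/-- `1/2 ≤ log(r + 2)` for `r ≥ 0` (`log 2 = 0.693…`). [folklore] -/
theorem half_le_log_add_two {r : ℝ} (hr : 0 ≤ r) : 1 / 2 ≤ Real.log (r + 2) := by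
  have h2 := Real.log_two_gt_d9
  have h3 : Real.log 2 ≤ Real.log (r + 2) := Real.log_le_log two_pos (by linarith)
  norm_num at h2
  linarith

/-- The boundary budget: `(r+1)^N ≤ e^{N r} ≤ e^{2 N r log(r+2)}` for `r ≥ 0`. [folklore] -/
theorem pow_le_exp_budget {r : ℝ} (hr : 0 ≤ r) (N : ℕ) :
    (r + 1) ^ N ≤ Real.exp (2 * N * r * Real.log (r + 2)) := by
  have hℓ := half_le_log_add_two hr
  calc (r + 1) ^ N ≤ Real.exp r ^ N := pow_le_pow_left₀ (by linarith) (Real.add_one_le_exp r) N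
    _ = Real.exp (N * r) := (Real.exp_nat_mul r N).symm
    _ ≤ Real.exp (2 * N * r * Real.log (r + 2)) := by
        rw [Real.exp_le_exp]
        have h0 : 0 ≤ (N : ℝ) * r := by positivity
        nlinarith

/-- Uniform constants over the finitely many characters mod `q`: from a bound
`A_χ y (log y)^{Re z−1} e^{C_χ r log(r+2)}` for `y ≥ y₀(χ)` for each `χ` one gets the same bound
with `A* = Σ_χ |A_χ| ≥ 0`, `C* = Σ_χ |C_χ| ≥ 0`, `y₀* = Σ_χ y₀(χ)` for all `χ` at once. [folklore] -/
theorem uniform_char_bound {q : ℕ} [NeZero q]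
    (h : ∀ χ : DirichletCharacter ℂ q, ∃ A C : ℝ, ∃ y₀ : ℕ, ∀ y : ℕ, y₀ ≤ y → ∀ z : ℂ,
      ‖z - 1‖ ≤ 3 * Real.log (Real.log (y : ℝ)) →
        ‖∑ n ∈ Finset.Ioc 0 y, χ (n : ZMod q) * z ^ (n.factorization.sum fun _ v => min v 2)‖ ≤
          A * (y : ℝ) * Real.log (y : ℝ) ^ (z.re - 1) *
            Real.exp (C * ‖z - 1‖ * Real.log (‖z - 1‖ + 2))) :
    ∃ A C : ℝ, ∃ y₀ : ℕ, 0 ≤ A ∧ 0 ≤ C ∧ ∀ y : ℕ, y₀ ≤ y → ∀ z : ℂ,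
      ‖z - 1‖ ≤ 3 * Real.log (Real.log (y : ℝ)) → ∀ χ : DirichletCharacter ℂ q,
        ‖∑ n ∈ Finset.Ioc 0 y, χ (n : ZMod q) * z ^ (n.factorization.sum fun _ v => min v 2)‖ ≤
          A * (y : ℝ) * Real.log (y : ℝ) ^ (z.re - 1) *
            Real.exp (C * ‖z - 1‖ * Real.log (‖z - 1‖ + 2)) := by
  choose A C y₀ hb using h
  refine ⟨∑ χ, |A χ|, ∑ χ, |C χ|, ∑ χ, y₀ χ, Finset.sum_nonneg fun χ _ => abs_nonneg _,
    Finset.sum_nonneg fun χ _ => abs_nonneg _, fun y hy z hz χ => ?_⟩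
  have hyχ : y₀ χ ≤ y :=
    le_trans (Finset.single_le_sum (f := y₀) (fun _ _ => Nat.zero_le _) (Finset.mem_univ χ)) hy
  have hAχ : A χ ≤ ∑ χ', |A χ'| :=
    (le_abs_self _).trans
      (Finset.single_le_sum (f := fun χ' => |A χ'|) (fun _ _ => abs_nonneg _) (Finset.mem_univ χ))
  have hCχ : C χ ≤ ∑ χ', |C χ'| :=
    (le_abs_self _).trans
      (Finset.single_le_sum (f := fun χ' => |C χ'|) (fun _ _ => abs_nonneg _) (Finset.mem_univ χ))
  have hr0 : 0 ≤ ‖z - 1‖ := norm_nonneg _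
  have hℓ : 0 ≤ Real.log (‖z - 1‖ + 2) := Real.log_nonneg (by linarith)
  have hL : 0 ≤ Real.log (y : ℝ) ^ (z.re - 1) := by positivity
  have hy0 : (0 : ℝ) ≤ y := Nat.cast_nonneg y
  calc ‖∑ n ∈ Finset.Ioc 0 y, χ (n : ZMod q) * z ^ (n.factorization.sum fun _ v => min v 2)‖
      ≤ A χ * (y : ℝ) * Real.log (y : ℝ) ^ (z.re - 1) *
          Real.exp (C χ * ‖z - 1‖ * Real.log (‖z - 1‖ + 2)) := hb χ y hyχ z hz
    _ ≤ (∑ χ', |A χ'|) * (y : ℝ) * Real.log (y : ℝ) ^ (z.re - 1) *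
          Real.exp (C χ * ‖z - 1‖ * Real.log (‖z - 1‖ + 2)) := by
        have h0 : 0 ≤ Real.exp (C χ * ‖z - 1‖ * Real.log (‖z - 1‖ + 2)) := (Real.exp_pos _).le
        exact mul_le_mul_of_nonneg_right
          (mul_le_mul_of_nonneg_right (mul_le_mul_of_nonneg_right hAχ hy0) hL) h0
    _ ≤ (∑ χ', |A χ'|) * (y : ℝ) * Real.log (y : ℝ) ^ (z.re - 1) *
          Real.exp ((∑ χ', |C χ'|) * ‖z - 1‖ * Real.log (‖z - 1‖ + 2)) := by
        have h0 : 0 ≤ (∑ χ', |A χ'|) * (y : ℝ) * Real.log (y : ℝ) ^ (z.re - 1) :=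
          mul_nonneg (mul_nonneg (Finset.sum_nonneg fun χ _ => abs_nonneg _) hy0) hL
        refine mul_le_mul_of_nonneg_left (Real.exp_le_exp.2 ?_) h0
        exact mul_le_mul_of_nonneg_right (mul_le_mul_of_nonneg_right hCχ hr0) hℓ

/-- `1 ≤ x (log x)^p` on the growing disc: for `x ≥ exp(exp 9)`, `p ≥ −r`, `r ≤ 3 log log x`
(`x (log x)^p ≥ exp(e^ℓ − 3ℓ²) ≥ 1`, `ℓ = log log x ≥ 9`). [folklore] -/
theorem one_le_mul_log_rpow_growing {x p r : ℝ} (hx : Real.exp (Real.exp 9) ≤ x) (hp : -r ≤ p)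
    (hr : r ≤ 3 * Real.log (Real.log x)) : 1 ≤ x * Real.log x ^ p := by
  have hxpos : 0 < x := (Real.exp_pos _).trans_le hx
  have hlogx : Real.exp 9 ≤ Real.log x := (Real.le_log_iff_exp_le hxpos).2 hx
  have h𝓛pos : 0 < Real.log x := (Real.exp_pos _).trans_le hlogx
  have hL9 : 9 ≤ Real.log (Real.log x) := (Real.le_log_iff_exp_le h𝓛pos).2 hlogx
  have hL0 : 0 < Real.log (Real.log x) := by linarith
  have hpow : Real.log x ^ p = Real.exp (Real.log (Real.log x) * p) := Real.rpow_def_of_pos h𝓛pos p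
  have hxeq : x = Real.exp (Real.exp (Real.log (Real.log x))) := by
    rw [Real.exp_log h𝓛pos, Real.exp_log hxpos]
  have h1 : -(Real.log (Real.log x) * r) ≤ Real.log (Real.log x) * p := by
    have := mul_le_mul_of_nonneg_left hp hL0.le
    linarith
  have h2 : Real.log (Real.log x) * r ≤ 3 * Real.log (Real.log x) ^ 2 := by
    have := mul_le_mul_of_nonneg_left hr hL0.le
    nlinarith
  have h3 : 3 * Real.log (Real.log x) ^ 2 ≤ Real.exp (Real.log (Real.log x)) :=
    GrowingDiscX.three_sq_le_exp hL9
  rw [hpow]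
  nth_rewrite 1 [hxeq]
  rw [← Real.exp_add]
  exact Real.one_le_exp (by linarith)

/-- The real-number assembly of the three pieces `N₀ + U + B₁` against
`A · x (log x)^p · e^{C r ℓ}`: with `Q = x·Lx ≥ 1`, `n₀ ≤ |b| + 1`,
`u ≤ nχ (A* y Ly e^{C* r ℓ})`, `y ≤ κ x`, `Ly ≤ Lx e^{r log κ}`, `b₁ ≤ |b| e^{2N r ℓ}`, `ℓ ≥ 1/2`, one has
`n₀ + u + b₁ ≤ (2|b| + 1 + nχ A* κ) · x · Lx · e^{(C* + 2 log κ + 2N) r ℓ}`. [folklore] -/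
theorem real_assembly {x Lx y Ly κ lκ r ℓ n0 u b1 Bb nχ As Cs Nr : ℝ}
    (hQ : 1 ≤ x * Lx) (hx : 0 ≤ x) (hn0 : n0 ≤ Bb + 1)
    (hu : u ≤ nχ * (As * y * Ly * Real.exp (Cs * r * ℓ)))
    (hyκ : y ≤ κ * x) (hlogy : Ly ≤ Lx * Real.exp (r * lκ)) (hLy : 0 ≤ Ly) (hLx : 0 ≤ Lx)
    (hb1 : b1 ≤ Bb * Real.exp (2 * Nr * r * ℓ))
    (hBb : 0 ≤ Bb) (hnχ : 0 ≤ nχ) (hAs : 0 ≤ As) (hκ : 1 ≤ κ) (hlκ : 0 ≤ lκ) (hr : 0 ≤ r)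
    (hℓ : 1 / 2 ≤ ℓ) (hCs : 0 ≤ Cs) (hNr : 0 ≤ Nr) :
    n0 + u + b1 ≤
      (2 * Bb + 1 + nχ * As * κ) * x * Lx * Real.exp ((Cs + 2 * lκ + 2 * Nr) * r * ℓ) := by
  have hℓ0 : 0 ≤ ℓ := by linarith
  have hκ0 : 0 ≤ κ := by linarith
  have hE1 : 1 ≤ Real.exp ((Cs + 2 * lκ + 2 * Nr) * r * ℓ) :=
    Real.one_le_exp (mul_nonneg (mul_nonneg (by positivity) hr) hℓ0)
  have hE0 : 0 ≤ Real.exp ((Cs + 2 * lκ + 2 * Nr) * r * ℓ) := (Real.exp_pos _).le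
  have he1 : Real.exp (r * lκ) * Real.exp (Cs * r * ℓ) ≤ Real.exp ((Cs + 2 * lκ + 2 * Nr) * r * ℓ) := by
    rw [← Real.exp_add, Real.exp_le_exp]
    have h1 : 0 ≤ r * lκ * (2 * ℓ - 1) := mul_nonneg (mul_nonneg hr hlκ) (by linarith)
    have h2 : 0 ≤ Nr * r * ℓ := mul_nonneg (mul_nonneg hNr hr) hℓ0
    nlinarith
  have he2 : Real.exp (2 * Nr * r * ℓ) ≤ Real.exp ((Cs + 2 * lκ + 2 * Nr) * r * ℓ) := by
    rw [Real.exp_le_exp]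
    have h2 : 0 ≤ (Cs + 2 * lκ) * r * ℓ := mul_nonneg (mul_nonneg (by positivity) hr) hℓ0
    nlinarith
  have hQ0 : 0 ≤ x * Lx := mul_nonneg hx hLx
  -- term 1
  have t1 : n0 ≤ (Bb + 1) * (x * Lx) * Real.exp ((Cs + 2 * lκ + 2 * Nr) * r * ℓ) := by
    calc n0 ≤ Bb + 1 := hn0
      _ ≤ (Bb + 1) * (x * Lx) := le_mul_of_one_le_right (by linarith) hQ
      _ ≤ (Bb + 1) * (x * Lx) * Real.exp ((Cs + 2 * lκ + 2 * Nr) * r * ℓ) :=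
          le_mul_of_one_le_right (mul_nonneg (by linarith) hQ0) hE1
  -- term 2
  have t2 : u ≤ nχ * As * κ * (x * Lx) * Real.exp ((Cs + 2 * lκ + 2 * Nr) * r * ℓ) := by
    have hyLy : y * Ly ≤ (κ * x) * (Lx * Real.exp (r * lκ)) :=
      mul_le_mul hyκ hlogy hLy (mul_nonneg hκ0 hx)
    have hnA : 0 ≤ nχ * As := mul_nonneg hnχ hAs
    calc u ≤ nχ * (As * y * Ly * Real.exp (Cs * r * ℓ)) := hu
      _ = nχ * As * (y * Ly) * Real.exp (Cs * r * ℓ) := by ring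
      _ ≤ nχ * As * ((κ * x) * (Lx * Real.exp (r * lκ))) * Real.exp (Cs * r * ℓ) :=
          mul_le_mul_of_nonneg_right (mul_le_mul_of_nonneg_left hyLy hnA) (Real.exp_pos _).le
      _ = nχ * As * κ * (x * Lx) * (Real.exp (r * lκ) * Real.exp (Cs * r * ℓ)) := by ring
      _ ≤ nχ * As * κ * (x * Lx) * Real.exp ((Cs + 2 * lκ + 2 * Nr) * r * ℓ) :=
          mul_le_mul_of_nonneg_left he1 (mul_nonneg (mul_nonneg hnA hκ0) hQ0)
  -- term 3
  have t3 : b1 ≤ Bb * (x * Lx) * Real.exp ((Cs + 2 * lκ + 2 * Nr) * r * ℓ) := by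
    calc b1 ≤ Bb * Real.exp (2 * Nr * r * ℓ) := hb1
      _ ≤ Bb * Real.exp ((Cs + 2 * lκ + 2 * Nr) * r * ℓ) := mul_le_mul_of_nonneg_left he2 hBb
      _ ≤ Bb * Real.exp ((Cs + 2 * lκ + 2 * Nr) * r * ℓ) * (x * Lx) :=
          le_mul_of_one_le_right (mul_nonneg hBb hE0) hQ
      _ = Bb * (x * Lx) * Real.exp ((Cs + 2 * lκ + 2 * Nr) * r * ℓ) := by ring
  calc n0 + u + b1 ≤ (Bb + 1) * (x * Lx) * Real.exp ((Cs + 2 * lκ + 2 * Nr) * r * ℓ) +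
        nχ * As * κ * (x * Lx) * Real.exp ((Cs + 2 * lκ + 2 * Nr) * r * ℓ) +
        Bb * (x * Lx) * Real.exp ((Cs + 2 * lκ + 2 * Nr) * r * ℓ) := add_le_add (add_le_add t1 t2) t3
    _ = (2 * Bb + 1 + nχ * As * κ) * x * Lx * Real.exp ((Cs + 2 * lκ + 2 * Nr) * r * ℓ) := by ring

end GrowingDiscLinearAP

/-- **Stub `stub_growingDiscLinearOfCharBound` (the cell `k = 1`, `f = aX + b`, `a ≥ 2`,
`gcd(a,b) = 1` of the crux on the growing disc, from the per-character bound CHAR).**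
For `x ≥ x₀` and `‖z − 1‖ ≤ 3 log log x`,
`‖Σ_{0≤n≤x} z^{s((an+b)⁺)}‖ ≤ A x (log x)^{Re z − 1} e^{C‖z−1‖ log(‖z−1‖+2)}`: reindex to the
progression `m ≡ b (mod a)`, `0 < m ≤ y = ax + b` (`stub_apTiltedReindex`), expand the progression
through the Dirichlet characters mod `a` (`norm_progression_sum_le`, `b` a unit mod `a`), apply CHAR
at `y ≥ x` with constants made uniform over the finitely many characters, convert `y ↦ x`
(`y ≤ (a+|b|)x`, `log_rpow_le_of_le_mul`), and absorb the boundary terms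
`(|b|+1) + |b|(1+‖z−1‖)^{2|b|+2}` using `x (log x)^{Re z−1} ≥ 1` (`log log x ≥ 9`) and
`(1+r)^N ≤ e^{2N r log(r+2)}`.  Constants: `A = 2|b| + 1 + #{χ mod a}·(Σ_χ|A_χ|)·(a+|b|)`,
`C = Σ_χ|C_χ| + 2 log(a+|b|) + 2(2|b|+2)`, `x₀ = max (max (Σ_χ y₀(χ)) |b|) ⌈exp(exp 9)⌉₊`.
[cite: MontgomeryVaughan2007, §7.4 Theorems 7.17–7.18 and §11.3] -/
theorem stub_growingDiscLinearOfCharBound : (∀ (q : ℕ) [NeZero q] (χ : DirichletCharacter ℂ q), ∃ A C : ℝ, ∃ y₀ : ℕ, ∀ y : ℕ, y₀ ≤ y → ∀ z : ℂ, ‖z - 1‖ ≤ 3 * Real.log (Real.log (y : ℝ)) → ‖∑ n ∈ Finset.Ioc 0 y, χ (n : ZMod q) * z ^ (n.factorization.sum fun _ v => min v 2)‖ ≤ A * (y : ℝ) * Real.log (y : ℝ) ^ (z.re - 1) * Real.exp (C * ‖z - 1‖ * Real.log (‖z - 1‖ + 2))) → ∀ (a b : ℤ), 2 ≤ a → IsCoprime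 a b → ∃ A C : ℝ, ∃ x₀ : ℕ, ∀ x : ℕ, x₀ ≤ x → ∀ z : ℂ, ‖z - 1‖ ≤ 3 * Real.log (Real.log (x : ℝ)) → ‖(∑ n ∈ Finset.range (x + 1), (z : ℂ) ^ (∑ i, ((((![Polynomial.C a * Polynomial.X + Polynomial.C b] : Fin 1 → Polynomial ℤ) i).eval (n : ℤ)).toNat.factorization.sum fun _ v => min v 2)))‖ ≤ A * (x : ℝ) * (Real.log (x : ℝ)) ^ (((1 : ℕ) : ℝ) * ((z : ℂ).re - 1)) * Real.exp (C * ‖(z : ℂ) - 1‖ * Real.log (‖(z : ℂ) - 1‖ + 2)) := by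
  intro hCHAR a b ha hab
  haveI : NeZero a.toNat := ⟨by omega⟩
  obtain ⟨As, Cs, ys, hAs, hCs, hbound⟩ :=
    GrowingDiscLinearAP.uniform_char_bound (q := a.toNat) fun χ => hCHAR a.toNat χ
  have hβ : IsUnit ((b : ℤ) : ZMod a.toNat) := isUnit_intCast_zmod_of_isCoprime (by omega) hab
  refine ⟨2 * (b.natAbs : ℝ) + 1 + (Fintype.card (DirichletCharacter ℂ a.toNat) : ℝ) * As *
      ((a : ℝ) + b.natAbs),
    Cs + 2 * Real.log ((a : ℝ) + b.natAbs) + 2 * ((2 * b.natAbs + 2 : ℕ) : ℝ),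
    max (max ys b.natAbs) ⌈Real.exp (Real.exp 9)⌉₊, fun x hx z hz => ?_⟩
  simp_rw [GrowingDiscLinearAP.exponent_linear a b]
  rw [Nat.cast_one, one_mul, stub_apTiltedReindex a b x z ha]
  -- unpacking the threshold
  have hys : ys ≤ x := le_trans ((le_max_left _ _).trans (le_max_left _ _)) hx
  have hxb : b.natAbs ≤ x := le_trans ((le_max_right _ _).trans (le_max_left _ _)) hx
  have hxexp : Real.exp (Real.exp 9) ≤ (x : ℝ) :=
    (Nat.le_ceil _).trans (by exact_mod_cast (le_max_right _ _).trans hx)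
  have hxpos : (0 : ℝ) < x := (Real.exp_pos _).trans_le hxexp
  have hlogx : Real.exp 9 ≤ Real.log x := (Real.le_log_iff_exp_le hxpos).2 hxexp
  have h9 : (1 : ℝ) ≤ Real.exp 9 := Real.one_le_exp (by norm_num)
  have hlogx1 : 1 ≤ Real.log (x : ℝ) := h9.trans hlogx
  have hlogxpos : 0 < Real.log (x : ℝ) := by linarith
  have hx1 : (1 : ℝ) ≤ x := (Real.one_le_exp (Real.exp_pos 9).le).trans hxexp
  -- the size constant `κ = a + |b|`
  have ha2 : (2 : ℝ) ≤ (a : ℝ) := by exact_mod_cast ha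
  have hκ1 : (1 : ℝ) ≤ (a : ℝ) + b.natAbs := by
    have h2 : (0 : ℝ) ≤ b.natAbs := Nat.cast_nonneg _
    linarith
  have hlκ : 0 ≤ Real.log ((a : ℝ) + b.natAbs) := Real.log_nonneg hκ1
  -- the endpoint `y = a x + b ≥ x`
  have hbabs : -b ≤ (b.natAbs : ℤ) := by rw [Int.natCast_natAbs]; exact neg_le_abs b
  have hxbZ : (b.natAbs : ℤ) ≤ x := by exact_mod_cast hxb
  have hx0Z : (0 : ℤ) ≤ x := by positivity
  have hxyZ : (x : ℤ) ≤ a * x + b := by nlinarith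
  have hy0 : 0 ≤ a * (x : ℤ) + b := hx0Z.trans hxyZ
  generalize hy : (a * (x : ℤ) + b).toNat = y
  have hycast : ((y : ℕ) : ℤ) = a * x + b := by rw [← hy]; exact Int.toNat_of_nonneg hy0
  have hyreal : ((y : ℕ) : ℝ) = (a : ℝ) * x + b := by exact_mod_cast hycast
  have hxyN : x ≤ y := by
    have h : (x : ℤ) ≤ y := by rw [hycast]; exact hxyZ
    exact_mod_cast h
  have hxy : (x : ℝ) ≤ y := by exact_mod_cast hxyN
  have hyκ : (y : ℝ) ≤ ((a : ℝ) + b.natAbs) * x := by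
    have h1 : (b : ℝ) ≤ (b.natAbs : ℝ) := by
      rw [Nat.cast_natAbs, Int.cast_abs]; exact le_abs_self _
    have h2 : (b.natAbs : ℝ) ≤ (b.natAbs : ℝ) * x := le_mul_of_one_le_right (Nat.cast_nonneg _) hx1
    rw [hyreal]
    nlinarith
  -- the radius bookkeeping
  have hr0 : 0 ≤ ‖z - 1‖ := norm_nonneg _
  have hzR : ‖z‖ ≤ ‖z - 1‖ + 1 := by
    have h := norm_add_le (z - 1) 1
    simp only [sub_add_cancel, norm_one] at h
    exact h
  have hre : -‖z - 1‖ ≤ z.re - 1 ∧ z.re - 1 ≤ ‖z - 1‖ := by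
    have h1 : |(z - 1).re| ≤ ‖z - 1‖ := Complex.abs_re_le_norm _
    have h2 : (z - 1).re = z.re - 1 := by simp
    rw [h2] at h1
    exact ⟨by linarith [neg_abs_le (z.re - 1)], by linarith [le_abs_self (z.re - 1)]⟩
  have hz' : ‖z - 1‖ ≤ 3 * Real.log (Real.log (y : ℝ)) := by
    have h1 : Real.log (x : ℝ) ≤ Real.log y := Real.log_le_log hxpos hxy
    have h2 : Real.log (Real.log (x : ℝ)) ≤ Real.log (Real.log y) := Real.log_le_log hlogxpos h1
    linarith
  -- the three pieces
  have hU := norm_progression_sum_le hβ y z fun χ => hbound y (hys.trans hxyN) z hz' χ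
  have hN0 : ((((Finset.range (x + 1)).filter fun n : ℕ => a * (n : ℤ) + b ≤ 0).card : ℕ) : ℝ) ≤
      (b.natAbs : ℝ) + 1 := by
    exact_mod_cast card_filter_nonpos_le a b x ha
  have hB1 := (norm_boundary_sum_le (a := a) (b := b) (y := y) (z := z) (R := ‖z - 1‖ + 1)
    (by linarith) hzR).trans (mul_le_mul_of_nonneg_left
      (GrowingDiscLinearAP.pow_le_exp_budget hr0 (2 * b.natAbs + 2)) (Nat.cast_nonneg _))
  -- sizes
  have hQ : 1 ≤ (x : ℝ) * Real.log x ^ (z.re - 1) :=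
    GrowingDiscLinearAP.one_le_mul_log_rpow_growing hxexp hre.1 hz
  have hlogy : Real.log (y : ℝ) ^ (z.re - 1) ≤
      Real.log (x : ℝ) ^ (z.re - 1) * Real.exp (‖z - 1‖ * Real.log ((a : ℝ) + b.natAbs)) :=
    log_rpow_le_of_le_mul hxpos hlogx1 hxy hyκ hκ1 hre.2 hre.1
  have hLy : 0 ≤ Real.log (y : ℝ) ^ (z.re - 1) := by positivity
  have hLx : 0 ≤ Real.log (x : ℝ) ^ (z.re - 1) := by positivity
  -- assembly
  refine (norm_sub_le _ _).trans ?_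
  refine (add_le_add (norm_add_le _ _) le_rfl).trans ?_
  rw [Complex.norm_natCast]
  exact GrowingDiscLinearAP.real_assembly hQ hxpos.le hN0 hU hyκ hlogy hLy hLx hB1 (Nat.cast_nonneg _)
    (Nat.cast_nonneg _) hAs hκ1 hlκ hr0 (GrowingDiscLinearAP.half_le_log_add_two hr0) hCs
    (Nat.cast_nonneg _)

end Summit.Parity.BatemanHorn.Cruxes.DiscMajorantLog.Sketch

end
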